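import Literature.Analysis.Pluripotential.NonPluripolarMongeAmpereMassSiuProofs
import HarnessLib

/-!
# The closed positive `(1,1)`-current `(c/d)·[F = 0]` of a homogeneous polynomial on `ℙᴺ(ℂ)`,
and Siu's theorem for it

Topic `Literature/Analysis/Pluripotential`. For a non-zero homogeneous polynomial `F` of degree
`d ≥ 1` in `N + 1` variables and a real `c ≥ 0`, the function `V = (c/d) log |F|` on
`ℂ^{N+1} ∖ {0}` (value `-∞` on the cone `{F = 0}`) is plurisubharmonic
(`isPlurisubharmonicOn_log_enorm_mvPolynomial_eval`), logarithmically homogeneous of degree `c`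
and not identically `-∞` near any point; it is the cone potential of the closed positive
`(1,1)`-current `T_F = (c/d) [F = 0]` of degree `c` on `ℙᴺ(ℂ)` — the current of integration along
the projective hypersurface `{F = 0}` counted with its multiplicities, scaled to degree `c`
(Lelong–Poincaré). This file packages `T_F` as a `ClosedPositiveOneOneCurrent N`
(`ClosedPositiveOneOneCurrent.ofHomogeneousPolynomial`, a DEFINITION with body) and proves
**Siu's theorem for these currents**: for every `c' > 0` the Lelong upper level set `E_{c'}(T_F)` is
an analytic subset of `ℙᴺ(ℂ)` (`isAnalyticSet_lelongUpperLevelSet_ofHomogeneousPolynomial`), by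
the reduction to the affine charts (`isAnalyticSet_lelongUpperLevelSet_of_chartPotentials`), the
computation of the Lelong numbers of `log |g|` as orders of vanishing (Hörmander, *Notions of
Convexity*, Cor. 4.1.18; `natCast_le_lelongNumber_log_enorm_eval_iff`) and the algebraicity of the
vanishing-order level sets (`isAnalyticSet_lelongUpperLevelSet_log_enorm_eval`), all in
`NonPluripolarMongeAmpereMassSiuProofs.lean`. So the named fact
`Siu1974_isAnalyticSet_lelongUpperLevelSet` holds for all currents with algebraic logarithmic
potential; here `E_{c'}(T_F) = {x | mult_x F ≥ c' d / c}`.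

## References

* [Siu1974] Y.-T. Siu, Analyticity of sets associated to Lelong numbers and the extension of
  closed positive currents, Invent. Math. 27 (1974): Main Theorem.
* L. Hörmander, Notions of Convexity (1994), Cor. 4.1.18 (Lelong number of `log |f|` = order of
  the zero), Thm. 4.3.3.
* [HormanderSCV1973] L. Hörmander, An introduction to complex analysis in several variables
  (1973), Cor. 1.6.6 and §2.6 (`log |f|` is plurisubharmonic).
-/

noncomputable section

open scoped Topology ENNReal Manifold ContDiff LinearAlgebra.Projectivization
open MeasureTheory Filter Set Metric MvPolynomial

namespace Literature.Analysis.Pluripotential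

namespace ClosedPositiveOneOneCurrent

variable {N : ℕ}

/-- **Log-homogeneity of `(c/d) log |F|`**: `F(a v) = aᵈ F(v)` gives
`(c/d) log |F(a v)| = (c/d) log |F(v)| + c log |a|` (both sides `-∞` on the cone `{F = 0}` when
`c > 0`, both `0` when `c = 0`). [folklore] -/
theorem const_mul_log_enorm_eval_smul {F : MvPolynomial (Fin (N + 1)) ℂ} {d : ℕ}
    (hF : F.IsHomogeneous d) (hd : 0 < d) {c : ℝ} (hc : 0 ≤ c) {a : ℂ} (ha : a ≠ 0)
    (v : Fin (N + 1) → ℂ) :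
    ((c / d : ℝ) : EReal) * ENNReal.log ‖eval (a • v) F‖ₑ =
      ((c / d : ℝ) : EReal) * ENNReal.log ‖eval v F‖ₑ + ((c * Real.log ‖a‖ : ℝ) : EReal) := by
  rw [Projectivization.eval_smul_of_isHomogeneous hF, enorm_mul, ENNReal.log_mul_add, enorm_pow,
    ENNReal.log_pow, log_enorm_eq_coe ha]
  have hd0 : (d : ℝ) ≠ 0 := by exact_mod_cast hd.ne'
  rcases eq_or_ne (eval v F) 0 with h0 | h0
  · rw [h0, enorm_zero, ENNReal.log_zero, EReal.add_bot]
    rcases hc.eq_or_lt with rfl | hc'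
    · simp
    · have hcd : (0 : ℝ) < c / d := div_pos hc' (Nat.cast_pos.2 hd)
      rw [EReal.coe_mul_bot_of_pos hcd, EReal.bot_add]
  · rw [log_enorm_eq_coe h0, ← EReal.coe_coe_eq_natCast, ← EReal.coe_mul, ← EReal.coe_add,
      ← EReal.coe_mul, ← EReal.coe_mul, ← EReal.coe_add, EReal.coe_eq_coe_iff]
    field_simp
    ring

/-- **The current `T_F = (c/d) [F = 0]` of a homogeneous polynomial** `F ≠ 0` of degree `d ≥ 1` on
`ℙᴺ(ℂ)`, scaled to degree `c ≥ 0`: the closed positive `(1,1)`-current with cone potential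
`V = (c/d) log |F|` (`-∞` on the cone over the hypersurface `{F = 0}`), plurisubharmonic
(`log |F|` is psh), log-homogeneous of degree `c` and `≢ -∞` near every point (a non-zero
polynomial does not vanish identically on any open set). For `c = d` this is the current of
integration `[F = 0]` along the hypersurface with multiplicities (Lelong–Poincaré formula
`dd^c log |F| = [F = 0]`). [cite: HormanderSCV1973, Cor. 1.6.6 and §2.6; folklore] -/
def ofHomogeneousPolynomial (F : MvPolynomial (Fin (N + 1)) ℂ) {d : ℕ} (hF : F.IsHomogeneous d)
    (hd : 0 < d) (hF0 : F ≠ 0) (c : ℝ) (hc : 0 ≤ c) : ClosedPositiveOneOneCurrent N where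
  pot v := ((c / d : ℝ) : EReal) * ENNReal.log ‖eval v F‖ₑ
  degree := c
  degree_nonneg := hc
  isPlurisubharmonicOn_pot :=
    ((isPlurisubharmonicOn_log_enorm_mvPolynomial_eval F).const_mul
      (div_nonneg hc (Nat.cast_nonneg d))).mono (subset_univ _)
  isLogHomogeneous_pot a v ha _ := const_mul_log_enorm_eval_smul hF hd hc ha v
  frequently_ne_bot v _ := (frequently_eval_ne_zero hF0 v).mono fun y hy ↦ by
    rw [log_enorm_eq_coe hy, ← EReal.coe_mul]
    exact EReal.coe_ne_bot _

/-- The cone potential of `T_F`. [folklore] -/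
@[simp] theorem ofHomogeneousPolynomial_pot (F : MvPolynomial (Fin (N + 1)) ℂ) {d : ℕ}
    (hF : F.IsHomogeneous d) (hd : 0 < d) (hF0 : F ≠ 0) (c : ℝ) (hc : 0 ≤ c)
    (v : Fin (N + 1) → ℂ) :
    (ofHomogeneousPolynomial F hF hd hF0 c hc).pot v =
      ((c / d : ℝ) : EReal) * ENNReal.log ‖eval v F‖ₑ := rfl

/-- The degree of `T_F` is `c` (every degree `c ≥ 0` occurs, with poles when `c > 0`).
[folklore] -/
@[simp] theorem degree_ofHomogeneousPolynomial (F : MvPolynomial (Fin (N + 1)) ℂ) {d : ℕ}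
    (hF : F.IsHomogeneous d) (hd : 0 < d) (hF0 : F ≠ 0) (c : ℝ) (hc : 0 ≤ c) :
    (ofHomogeneousPolynomial F hF hd hF0 c hc).degree = c := rfl

/-- The chart potentials of `T_F` are `(c/d) log |gᵢ|` for the chart restrictions
`gᵢ(w) = F(w₀, …, 1ᵢ, …, w_{N-1})`, polynomials in `N` variables. [folklore] -/
theorem ofHomogeneousPolynomial_pot_insertNth (F : MvPolynomial (Fin (N + 1)) ℂ) {d : ℕ}
    (hF : F.IsHomogeneous d) (hd : 0 < d) (hF0 : F ≠ 0) (c : ℝ) (hc : 0 ≤ c) (i : Fin (N + 1))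
    (w : Fin N → ℂ) :
    (ofHomogeneousPolynomial F hF hd hF0 c hc).pot (Fin.insertNth i 1 w) =
      ((c / d : ℝ) : EReal) *
        ENNReal.log ‖eval w (aeval (Fin.insertNth i (1 : MvPolynomial (Fin N) ℂ) X) F)‖ₑ := by
  rw [ofHomogeneousPolynomial_pot, eval_aeval_insertNth]

/-- **Siu's theorem for the currents `(c/d) [F = 0]`**: for a non-zero homogeneous polynomial `F`
of degree `d ≥ 1` in `N + 1` variables, `c ≥ 0` and every `c' > 0`, the Lelong upper level set
`E_{c'}(T_F) ⊆ ℙᴺ(ℂ)` is an analytic subset (it is the set of points where `F` vanishes to order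
`≥ c' d / c`). Proof: reduction to the `N + 1` affine charts
(`isAnalyticSet_lelongUpperLevelSet_of_chartPotentials`), `ν((c/d) log |gᵢ|, w) =
(c/d) ν(log |gᵢ|, w)` and Siu's theorem for `log |gᵢ|` on `ℂᴺ`
(`isAnalyticSet_lelongUpperLevelSet_log_enorm_eval`); for `N = 0`, `ℙ⁰` is a point.
[cite: Siu1974, Main Theorem (currents of integration along hypersurfaces)] -/
theorem isAnalyticSet_lelongUpperLevelSet_ofHomogeneousPolynomial
    (F : MvPolynomial (Fin (N + 1)) ℂ) {d : ℕ} (hF : F.IsHomogeneous d) (hd : 0 < d) (hF0 : F ≠ 0)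
    {c : ℝ} (hc : 0 ≤ c) {c' : ℝ} (hc' : 0 < c') :
    Literature.Geometry.Kaehler.IsAnalyticSet 𝓘(ℂ, Fin N → ℂ)
      ((ofHomogeneousPolynomial F hF hd hF0 c hc).lelongUpperLevelSet c') := by
  rcases Nat.eq_zero_or_pos N with hN | hN
  · subst hN
    haveI := subsingleton_projectivization_fin_one
    exact isAnalyticSet_of_subsingleton _ _
  · haveI : Nontrivial (Fin N → ℂ) := by
      haveI : Nonempty (Fin N) := ⟨⟨0, hN⟩⟩
      infer_instance
    refine (ofHomogeneousPolynomial F hF hd hF0 c hc).isAnalyticSet_lelongUpperLevelSet_of_chartPotentials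
      hN fun i ↦ ?_
    set g : MvPolynomial (Fin N) ℂ := aeval (Fin.insertNth i (1 : MvPolynomial (Fin N) ℂ) X) F
      with hg
    have hg0 : g ≠ 0 := aeval_insertNth_ne_zero hF hF0 i
    have hfun : (fun w' : Fin N → ℂ ↦
        (ofHomogeneousPolynomial F hF hd hF0 c hc).pot (Fin.insertNth i 1 w')) =
        fun w' ↦ ((c / d : ℝ) : EReal) * ENNReal.log ‖eval w' g‖ₑ :=
      funext fun w' ↦ ofHomogeneousPolynomial_pot_insertNth F hF hd hF0 c hc i w'
    rw [hfun]
    rcases hc.eq_or_lt with rfl | hcpos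
    · -- `c = 0`: the chart potential is `≡ 0`, the level set is empty
      have h0 : (fun w' : Fin N → ℂ ↦ (((0 : ℝ) / d : ℝ) : EReal) * ENNReal.log ‖eval w' g‖ₑ) =
          fun _ ↦ (0 : EReal) := by
        funext w'; simp
      rw [h0]
      have hempty : {w : Fin N → ℂ | c' ≤ Pluripotential.lelongNumber (fun _ : Fin N → ℂ ↦ (0 : EReal)) w} = ∅ := by
        ext w
        simp only [mem_setOf_eq, mem_empty_iff_false, iff_false, not_le]
        rw [lelongNumber_zero_fun]
        exact hc'
      rw [hempty]
      exact Literature.Geometry.Kaehler.isAnalyticSet_empty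
    · have hcd : 0 < c / d := div_pos hcpos (Nat.cast_pos.2 hd)
      have hset : {w : Fin N → ℂ | c' ≤ Pluripotential.lelongNumber
          (fun w' : Fin N → ℂ ↦ ((c / d : ℝ) : EReal) * ENNReal.log ‖eval w' g‖ₑ) w} =
          {w : Fin N → ℂ | c' / (c / d) ≤
            Pluripotential.lelongNumber (fun w' : Fin N → ℂ ↦ ENNReal.log ‖eval w' g‖ₑ) w} := by
        ext w
        rw [mem_setOf_eq, mem_setOf_eq, lelongNumber_const_mul hcd, div_le_iff₀ hcd, mul_comm]
      rw [hset]
      exact isAnalyticSet_lelongUpperLevelSet_log_enorm_eval hg0 hN _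

/-- **The Lelong numbers of `T_F` are multiplicities**: for `c > 0`,
`ν(T_F, x) ≥ c'` iff `F` vanishes to order `≥ ⌈c' d / c⌉` at (any representative of) `x`, i.e.
iff the homogeneous components of degree `< ⌈c' d / c⌉` of `F(X + x.rep)` vanish. So
`E_{c'}(T_F)` is the locus of points of multiplicity `≥ c' d / c` of the hypersurface `{F = 0}`.
[cite: Siu1974, Main Theorem; Hörmander, Notions of Convexity, Cor. 4.1.18] -/
theorem lelongUpperLevelSet_ofHomogeneousPolynomial_eq (F : MvPolynomial (Fin (N + 1)) ℂ) {d : ℕ}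
    (hF : F.IsHomogeneous d) (hd : 0 < d) (hF0 : F ≠ 0) {c : ℝ} (hc : 0 < c) (c' : ℝ) :
    (ofHomogeneousPolynomial F hF hd hF0 c hc.le).lelongUpperLevelSet c' =
      {x | ∀ j < ⌈c' * d / c⌉₊,
        homogeneousComponent j (aeval (fun k ↦ X k + C (x.rep k)) F) = 0} := by
  have hcd : 0 < c / d := div_pos hc (Nat.cast_pos.2 hd)
  ext x
  rw [mem_lelongUpperLevelSet_iff, mem_setOf_eq]
  -- `ν(T_F, x) = (c/d) ν(log |F|, x.rep)`
  have h1 : (ofHomogeneousPolynomial F hF hd hF0 c hc.le).lelongNumber x =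
      c / d * Pluripotential.lelongNumber
        (fun z : Fin (N + 1) → ℂ ↦ ENNReal.log ‖eval z F‖ₑ) x.rep := by
    show Pluripotential.lelongNumber (ofHomogeneousPolynomial F hF hd hF0 c hc.le).pot x.rep = _
    rw [← lelongNumber_const_mul hcd]
    rfl
  rw [h1, ← div_le_iff₀' hcd]
  have hmem := Set.ext_iff.1 (setOf_le_lelongNumber_log_enorm_eval hF0 (Nat.succ_le_succ (Nat.zero_le N))
    (c' / (c / d))) x.rep
  simp only [mem_setOf_eq] at hmem
  rw [hmem, div_div_eq_mul_div]

end ClosedPositiveOneOneCurrent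

end Literature.Analysis.Pluripotential

end
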